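import Summits.BirchSwinnertonDyer.BirchSwinnertonDyer.Theorems.EisensteinPrimesMazurMCOnCellBTwistbackOnePartnerAt
import Summits.BirchSwinnertonDyer.BirchSwinnertonDyer.Theorems.EisensteinPrimesMazurMCOnCellBTwistbackDisplay5568g1
import HarnessLib

/-!
# Crux 3 `MazurMCOnCellB` (stmt-BirchSwinnertonDyer-19033), line `twistback` v6 — the PER-PAIR CERTIFICATE DOORS of
# roads (b) / (d′) WITH THE HEEGNER DATUM AND STEP L DISCHARGED, and the template cell `(5568g1, 3)` re-displayed on
# readings only

Width seat bsd-line-x2-p1-w6 (gen 2), cell `bsd-eis`, 2026-08-28; `--supports stmt-BirchSwinnertonDyer-19033 --as helper`;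
sequel of `…TwistbackOnePartnerAt` (p663790, the per-pair core). HONEST FRAMING: conditional theorems only; no `def`, no named
fact introduced, no `sorry`; closes no registered stub; no summit statement, no Mazur main conjecture and no BSD is proved for
any curve unconditionally; 0 cells / labels / stubs / tiers move.

## What

LEAD g9's per-pair doors p640749 §4 / p642512 §5 (`…TwistbackOnePartnerCertificates.mazurMainConjectureAt_of_cellB_of_not_split_of_indexLowerBoundAt_of_{orderOne,lamMin}_twist`)
— the doors every A10 display of seat lam-a (`…TwistbackDisplay5568g1`, `…TwistbackDisplays01–09`) instantiates — take PER
PAIR a Heegner datum over `K` (`N`, `Dt`, `H`, `ι`, `P`, `hPt`, `hcM : p ∤ c(Dt)`) and STEP L there (`hlow`, = item -27489 at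
that datum) as HYPOTHESES. Here the same two doors are fed through the core `…OnePartnerAt.mazurMainConjectureAt_of_cellB_of_upper_partnerAt`,
which DISCHARGES those eight binders: the datum from `PublishedInputs` (parametrisation, Gross–Zagier, Kolyvagin) + Mazur 1978
Cor. 4.1 + Edixhoven + Darmon Thm. 3.6 at the OPTIMAL curve of the class (so no Manin hypothesis on `W` itself), STEP L from
item -27489 ⟸ Keller–Yin Thm. D + Poitou–Tate ×2 + Hsieh 2014 + Liu–Zhang–Zhang 2018 (all conjuncts of the v6 stubs 1, 2, 3a).

* §1 `mazurMainConjectureAt_of_cellB_of_not_split_of_orderOne_twistAt` — road (b): non-split X2b pair, admissible `K`,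
  `ord_{s=1} L(E^{(d_K)},s) = 1`, ONE minimal model `Wd` of the twist, the certificate `ord_{T=0} L_p(Wd) = 1` ⊢ MC at `(W,p)`.
* §2 `mazurMainConjectureAt_of_cellB_of_not_split_of_lamMin_twistAt` — road (d′): the same with `(μ_an, λ_an)(Wd) = (0, 1)`.
* §3 `mazurMainConjectureAt_5568g1_at_three_of_partner23_discharged` — the template cell of lam-a's displays
  (p648214 `…TwistbackDisplay5568g1.mazurMainConjectureAt_5568g1_at_three_of_partner23`) with its binders
  `Dt H ι P hPt hcM hlow` GONE: hypotheses = named facts + the readings `hr` (`r_an(E) = 0`, Cremona), `hN` (`N = 5568`),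
  `hrd` (`r_an(Wd) = 1`), `hμ0`/`hlam` (`(μ_an, λ_an)(Wd, 3) = (0, 1)`), for `K = ℚ(√−23)`, `Wd = 5568g1 ⊗ χ_{−23}`.

HYPOTHESES BY NAME (nothing asserted): `PublishedInputs` (stmt-…-19037), Disegni 2020 Thm. 4(1) `padicBSD_rankOne_nonsplitMult`,
Poitou–Tate ×2, Hsieh 2014 Thm. 1, Liu–Zhang–Zhang 2018, Mazur 1978 Cor. 4.1 (PUBLISHED / refereed), Keller–Yin 2024 Thm. D
(UNREFEREED PREPRINT). Per pair: fields, models, readings, one certificate. Displays only; every cell stays OPEN modulo the PRE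
input and its readings; nothing class-wide is claimed.

References: [JetchevSkinnerWan2017] §7.4.1; [KellerYin2024] Thm. D (PRE); [Disegni2020] Thm. 4; [SteinWuthrich2013] Thm. 6.1;
[GreenbergVatsal2000] Thm. (1.3); [Wuthrich2014] Thm. 16; [Mazur1978] Cor. 4.1; [Darmon2004] Thm. 3.6; [Miller2011LMS] Def. 1.1.
-/

set_option autoImplicit false
-- `Summit.BirchSwinnertonDyer.BirchSwinnertonDyer.…`: the summit and its single sub-problem share a name.
set_option linter.dupNamespace false

noncomputable section

open scoped Classical MatrixGroups ModularForm

open CongruenceSubgroup WeierstrassCurve NumberField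
  Literature.NumberTheory.EllipticCurves
  Literature.NumberTheory.EllipticCurves.ModularForms
  Literature.NumberTheory.QuadraticFields
  Literature.NumberTheory.EllipticCurves.Rank1Residual
  Literature.NumberTheory.EllipticCurves.Rank1Residual.Typed
  Literature.NumberTheory.EllipticCurves.Wuthrich2014
  Literature.NumberTheory.EllipticCurves.SteinWuthrich2013
  Literature.NumberTheory.EllipticCurves.GreenbergVatsal2000
  Literature.NumberTheory.EllipticCurves.Disegni2020
  Literature.NumberTheory.EllipticCurves.KellerYin2024
  Literature.NumberTheory.GaloisCohomology
  Summit.BirchSwinnertonDyer.Rank1Residual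
  Summit.BirchSwinnertonDyer.Rank1Residual.X2
  Summit.BirchSwinnertonDyer.Rank1Residual.X2.RouteGSplitDisplay5568g1Local
  Summit.BirchSwinnertonDyer.BirchSwinnertonDyer.Theses
  Summit.BirchSwinnertonDyer.BirchSwinnertonDyer.Theorems.EisensteinPrimesMazurMCOnCellBTwistbackOnePartnerCertificates
  Summit.BirchSwinnertonDyer.BirchSwinnertonDyer.Theorems.EisensteinPrimesMazurMCOnCellBTwistbackOnePartnerAt
  Summit.BirchSwinnertonDyer.BirchSwinnertonDyer.Theorems.EisensteinPrimesMazurMCOnCellBTwistbackDisplay5568g1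

namespace Summit.BirchSwinnertonDyer.BirchSwinnertonDyer.Theorems.EisensteinPrimesMazurMCOnCellBTwistbackOnePartnerAtCertificates

/-! ## §1. Road (b), per pair, non-split: `ord_{T=0} L_p(E^K) = 1` at ONE twist — datum and STEP L discharged -/

/-- **PER PAIR, NON-SPLIT, road (b) with the Heegner datum and STEP L DISCHARGED.** Data: `X2.CellB W p` with `p` NON-split;
`K` admissible (imaginary quadratic, Heegner for `N_W` and for `p`, `d_K` odd `< −4`) with `ord_{s=1} L(E^{(d_K)}, s) = 1`;
ONE globally minimal model `Wd` of `E^{(d_K)}` and the analytic certificate `ord_{T=0} L = 1` for THE non-split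
Mazur–Tate–Teitelbaum function of `Wd` (`hordL`, p640749 §3 shape). Then `Wd` is an X2c ∩ `GVPar` pair non-split at `p`
(`X2.classX2_twist`, `gvPar_of_not_gvPar_of_twist`, `X2.hasSplitMultiplicativeReductionAtPrime_iff_of_smul_eq_quadraticTwist`),
p640749 §3 `missingUpperBoundAt_of_cellC_of_not_split_of_gvPar_of_orderOne` gives its upper half, and the core
`mazurMainConjectureAt_of_cellB_of_upper_partnerAt` (p663790) concludes — its optimal-curve datum, Heegner point and STEP L
coming from the named facts. Inputs BY NAME: `PublishedInputs`, Disegni 2020 Thm. 4(1), Poitou–Tate ×2, Hsieh, LZZ, Mazur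
Cor. 4.1, Keller–Yin Thm. D (PRE). CONDITIONAL; nothing about any curve is proved unconditionally.
[claim: KellerYin2024, status: under-review] [cite: KellerYin2024, Thm. D = Thm. 5.1.3 (arXiv:2402.12781v2 L306–L309)]
[cite: Disegni2020, Thm. 4 (§3.2)] [cite: SteinWuthrich2013, Thm. 6.1 (p. 20), §4.2] [cite: GreenbergVatsal2000, Thm. (1.3) with pp. 14–15]
[cite: Wuthrich2014, Thm. 16 (p. 397)] [cite: Mazur1978, Cor. 4.1] [cite: Miller2011LMS, Def. 1.1] -/
theorem mazurMainConjectureAt_of_cellB_of_not_split_of_orderOne_twistAt (hP : EisensteinPrimes.PublishedInputs)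
    (hDis : padicBSD_rankOne_nonsplitMult)
    (hPT : ∀ (K : Type) [Field K] [NumberField K], poitouTate_selmerStructure_duality K)
    (hPT2 : ∀ (K : Type) [Field K] [NumberField K], poitouTate_sha_tateDual K)
    (hH : hsieh2014_exists_anticyclotomicPAdicLFunction)
    (hF : LiuZhangZhang2018.thm151_thm153_modularCurve_heegnerVector) (hMaz : mazur_not_dvd_maninConstant_of_odd)
    (hD : KellerYin2024.thmD_imcMult_exists_isBDPLFunction_isTorsion_charIdeal_eq_OPEN)
    (W : WeierstrassCurve ℚ) [W.IsElliptic] [W.IsGloballyMinimal] (p : ℕ) [Fact p.Prime]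
    (hc : X2.CellB W p) (hns : ¬ W.HasSplitMultiplicativeReductionAtPrime p)
    (K : Type) [Field K] [NumberField K] (hK : IsImaginaryQuadratic K)
    (hHN : SatisfiesHeegnerHypothesis (W.conductorNorm ℤ) K) (hHp : SatisfiesHeegnerHypothesis p K)
    (hodd : Odd (NumberField.discr K)) (hlt : NumberField.discr K < -4)
    (hr1 : (W.quadraticTwist (NumberField.discr K : ℚ)).analyticRank = 1)
    (Wd : WeierstrassCurve ℚ) [Wd.IsElliptic] [Wd.IsGloballyMinimal]
    (hWd : ∃ C : VariableChange ℚ, C • Wd = W.quadraticTwist (NumberField.discr K : ℚ))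
    (hordL : ∀ {M : ℕ} [NeZero M] (f : CuspForm (Gamma0 M) 2), IsNewformOf Wd f →
      ∀ (ϖ : ℚ), (ϖ : ℝ) * Wd.realPeriodRat = plusPeriod f →
      ∀ L : PowerSeries ℚ_[p], IsMultPAdicLFunctionOf f p (-1) L → L.order = ((1 : ℕ) : ℕ∞)) :
    X2.MazurMainConjectureAt W p := by
  have hpP : p.Prime := Fact.out
  have hp2 : p ≠ 2 := hc.2.1.1
  have hred : ¬ W.HasIrreducibleModPGaloisRep p := hc.2.1.2.1
  have hmult : W.HasMultiplicativeReductionAtPrime p := hc.2.1.2.2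
  obtain ⟨C, hC⟩ := hWd
  have hrd : Wd.analyticRank = 1 := by
    have h := congrArg WeierstrassCurve.analyticRank hC
    rw [analyticRank_smul] at h
    exact h.trans hr1
  have hneg : NumberField.discr K < 0 := IsImaginaryQuadratic.discr_neg hK
  have hpd : ¬ (p : ℤ) ∣ NumberField.discr K := not_dvd_discr_of_split hK hpP hp2 hHp
  have hXd : ClassX2 Wd p := X2.classX2_twist W p hc.2.1 K hK hHp Wd ⟨C, hC⟩
  have hgv : GVPar Wd p :=
    gvPar_of_not_gvPar_of_twist (W := W) (p := p) hp2 hred hc.2.2 hneg hpd Wd C (by simpa using hC)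
  have hnsd : ¬ Wd.HasSplitMultiplicativeReductionAtPrime p := fun hs ↦
    hns ((X2.hasSplitMultiplicativeReductionAtPrime_iff_of_smul_eq_quadraticTwist W Wd hK p hp2 hmult hHp
      hC).mp hs)
  have hUd : MissingUpperBoundAt Wd p :=
    missingUpperBoundAt_of_cellC_of_not_split_of_gvPar_of_orderOne hP hDis Wd p ⟨hrd, hXd⟩ hnsd hgv hordL
  exact mazurMainConjectureAt_of_cellB_of_upper_partnerAt hP hPT hPT2 hH hF hMaz hD W p hc K hK hHN hHp hodd hlt
    hr1 Wd ⟨C, hC⟩ hUd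

/-! ## §2. Road (d′), per pair, non-split: `(μ_an, λ_an)(E^K) = (0, 1)` at ONE twist — datum and STEP L discharged -/

/-- **PER PAIR, NON-SPLIT, two-engine form, with the Heegner datum and STEP L DISCHARGED**: as §1 with the analytic input
of the partner read off the two Iwasawa-invariant engines (`X2.AnalyticMuLE Wd p 0`, `X2.AnalyticLambdaEq Wd p 1`) —
p642512 §5 `missingUpperBoundAt_of_cellC_of_not_split_of_lamMin` (Kato–Wuthrich + λ-squeeze ⟹ MC and Schneider at the
partner; Disegni / Stein–Wuthrich the leading terms) for the upper half, then the core p663790. Inputs BY NAME as §1.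
CONDITIONAL; BSD / MC proved for no curve unconditionally. [claim: KellerYin2024, status: under-review]
[cite: GreenbergVatsal2000, p. 4 (λ-invariants) and Thm. (1.3)] [cite: Disegni2020, Thm. 4 (§3.2)]
[cite: SteinWuthrich2013, Thm. 6.1 (p. 20), §4.2] [cite: Wuthrich2014, Thm. 16 (p. 397)] [cite: Mazur1978, Cor. 4.1] -/
theorem mazurMainConjectureAt_of_cellB_of_not_split_of_lamMin_twistAt (hP : EisensteinPrimes.PublishedInputs)
    (hDis : padicBSD_rankOne_nonsplitMult)
    (hPT : ∀ (K : Type) [Field K] [NumberField K], poitouTate_selmerStructure_duality K)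
    (hPT2 : ∀ (K : Type) [Field K] [NumberField K], poitouTate_sha_tateDual K)
    (hH : hsieh2014_exists_anticyclotomicPAdicLFunction)
    (hF : LiuZhangZhang2018.thm151_thm153_modularCurve_heegnerVector) (hMaz : mazur_not_dvd_maninConstant_of_odd)
    (hD : KellerYin2024.thmD_imcMult_exists_isBDPLFunction_isTorsion_charIdeal_eq_OPEN)
    (W : WeierstrassCurve ℚ) [W.IsElliptic] [W.IsGloballyMinimal] (p : ℕ) [Fact p.Prime]
    (hc : X2.CellB W p) (hns : ¬ W.HasSplitMultiplicativeReductionAtPrime p)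
    (K : Type) [Field K] [NumberField K] (hK : IsImaginaryQuadratic K)
    (hHN : SatisfiesHeegnerHypothesis (W.conductorNorm ℤ) K) (hHp : SatisfiesHeegnerHypothesis p K)
    (hodd : Odd (NumberField.discr K)) (hlt : NumberField.discr K < -4)
    (hr1 : (W.quadraticTwist (NumberField.discr K : ℚ)).analyticRank = 1)
    (Wd : WeierstrassCurve ℚ) [Wd.IsElliptic] [Wd.IsGloballyMinimal]
    (hWd : ∃ C : VariableChange ℚ, C • Wd = W.quadraticTwist (NumberField.discr K : ℚ))
    (hμ0 : X2.AnalyticMuLE Wd p 0) (hlam : X2.AnalyticLambdaEq Wd p 1) :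
    X2.MazurMainConjectureAt W p := by
  have hp2 : p ≠ 2 := hc.2.1.1
  have hmult : W.HasMultiplicativeReductionAtPrime p := hc.2.1.2.2
  obtain ⟨C, hC⟩ := hWd
  have hrd : Wd.analyticRank = 1 := by
    have h := congrArg WeierstrassCurve.analyticRank hC
    rw [analyticRank_smul] at h
    exact h.trans hr1
  have hXd : ClassX2 Wd p := X2.classX2_twist W p hc.2.1 K hK hHp Wd ⟨C, hC⟩
  have hnsd : ¬ Wd.HasSplitMultiplicativeReductionAtPrime p := fun hs ↦
    hns ((X2.hasSplitMultiplicativeReductionAtPrime_iff_of_smul_eq_quadraticTwist W Wd hK p hp2 hmult hHp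
      hC).mp hs)
  have hUd : MissingUpperBoundAt Wd p :=
    missingUpperBoundAt_of_cellC_of_not_split_of_lamMin hP hDis Wd p ⟨hrd, hXd⟩ hnsd hμ0 hlam
  exact mazurMainConjectureAt_of_cellB_of_upper_partnerAt hP hPT hPT2 hH hF hMaz hD W p hc K hK hHN hHp hodd hlt
    hr1 Wd ⟨C, hC⟩ hUd

/-! ## §3. The template cell `(5568g1, 3)` on readings only -/

/-- **Cell `(5568g1, 3)` — partner field `ℚ(√−23)`, partner `Wd = 5568g1 ⊗ χ_{−23} = [0,−1,0,−260844257,−7644351037599]` —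
Mazur's main conjecture at `(E, 3)` from the named facts and FIVE READINGS: `hr` (`r_an(E) = 0`, Cremona), `hN`
(`N = 5568`, Cremona), `hrd` (`r_an(Wd) = 1`, PARI), `hμ0`/`hlam` (`(μ_an, λ_an)(Wd, 3) = (0, 1)`, ENGINE T ‖ PARI, lam-a
CA-g9-1).** This is lam-a's p648214 `mazurMainConjectureAt_5568g1_at_three_of_partner23` with its per-cell Heegner datum
`(Dt, H, ι, P, hPt, hcM)` and STEP L `hlow` DISCHARGED through §2: the kernel facts of the display file are reused by name
(`cellB_5568g1_of_analyticRank`, `nonsplit_5568g1`, `exists_variableChange_twist23`, `satisfiesHeegnerHypothesis_5568`,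
`satisfiesHeegnerHypothesis_3`, `isImaginaryQuadratic_of_discr_eq_of_neg`). The cell stays OPEN: Keller–Yin Thm. D is a
PREPRINT and the readings are not kernel facts. [claim: KellerYin2024, status: under-review]
[cite: KellerYin2024, Thm. D = Thm. 5.1.3 (arXiv:2402.12781v2 L306–L309)] [cite: GreenbergVatsal2000, Thm. (1.3), p. 4]
[cite: Disegni2020, Thm. 4 (§3.2)] [cite: SteinWuthrich2013, Thm. 6.1] [cite: Wuthrich2014, Thm. 16] [cite: Mazur1978, Cor. 4.1] -/
theorem mazurMainConjectureAt_5568g1_at_three_of_partner23_discharged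
    (hP : EisensteinPrimes.PublishedInputs) (hDis : padicBSD_rankOne_nonsplitMult)
    (hPT : ∀ (K : Type) [Field K] [NumberField K], poitouTate_selmerStructure_duality K)
    (hPT2 : ∀ (K : Type) [Field K] [NumberField K], poitouTate_sha_tateDual K)
    (hH : hsieh2014_exists_anticyclotomicPAdicLFunction)
    (hF : LiuZhangZhang2018.thm151_thm153_modularCurve_heegnerVector) (hMaz : mazur_not_dvd_maninConstant_of_odd)
    (hD : KellerYin2024.thmD_imcMult_exists_isBDPLFunction_isTorsion_charIdeal_eq_OPEN)
    (W : WeierstrassCurve ℚ) [W.IsElliptic] [W.IsGloballyMinimal] (hW : W = ⟨0, -1, 0, -493089, 628457121⟩)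
    (hr : W.analyticRank = 0) (hN : W.conductorNorm ℤ = 5568)
    (K : Type) [Field K] [NumberField K] (h2 : Module.finrank ℚ K = 2) (hdK : NumberField.discr K = -23)
    (Wd : WeierstrassCurve ℚ) [Wd.IsElliptic] [Wd.IsGloballyMinimal]
    (hWd : Wd = ⟨0, -1, 0, -260844257, -7644351037599⟩) (hrd : Wd.analyticRank = 1)
    (hμ0 : X2.AnalyticMuLE Wd 3 0) (hlam : X2.AnalyticLambdaEq Wd 3 1) :
    X2.MazurMainConjectureAt W 3 := by
  subst hW hWd
  have hK : IsImaginaryQuadratic K := isImaginaryQuadratic_of_discr_eq_of_neg h2 hdK (by norm_num)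
  have hodd : Odd (NumberField.discr K) := by rw [hdK]; exact ⟨-12, by norm_num⟩
  have hlt : NumberField.discr K < -4 := by rw [hdK]; norm_num
  have hWd' : ∃ C : VariableChange ℚ, C • (⟨0, -1, 0, -260844257, -7644351037599⟩ : WeierstrassCurve ℚ) =
      (⟨0, -1, 0, -493089, 628457121⟩ : WeierstrassCurve ℚ).quadraticTwist (NumberField.discr K : ℚ) := by
    rw [hdK]; exact exists_variableChange_twist23
  obtain ⟨C, hC⟩ := hWd'
  have hr1 : ((⟨0, -1, 0, -493089, 628457121⟩ : WeierstrassCurve ℚ).quadraticTwist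
      (NumberField.discr K : ℚ)).analyticRank = 1 := by
    rw [← hC, analyticRank_smul]; exact hrd
  have hHN : SatisfiesHeegnerHypothesis
      ((⟨0, -1, 0, -493089, 628457121⟩ : WeierstrassCurve ℚ).conductorNorm ℤ) K := by
    rw [hN]; exact satisfiesHeegnerHypothesis_5568 h2 hdK
  exact mazurMainConjectureAt_of_cellB_of_not_split_of_lamMin_twistAt hP hDis hPT hPT2 hH hF hMaz hD _ 3
    (cellB_5568g1_of_analyticRank hr) nonsplit_5568g1.2 K hK hHN (satisfiesHeegnerHypothesis_3 h2 hdK) hodd hlt hr1 _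
    ⟨C, hC⟩ hμ0 hlam

end Summit.BirchSwinnertonDyer.BirchSwinnertonDyer.Theorems.EisensteinPrimesMazurMCOnCellBTwistbackOnePartnerAtCertificates

end
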